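import Literature.MathematicalPhysics.QuantumFieldTheory.Federbush1986.PhaseCellIVGeomConstruction6

/-!
# `Federbush1986.PhaseCellIVSection11Submanifold` — [Federbush1988PhaseCellIV] §11 pp. 336–339 and Appendix A pp. 339–343:
# ALL SIX Geometric Constructions 1–6 and ALL FOUR Theorems A.1–A.4 (embedded capped readings of record) IN ONE DECL, for
# every compact (connected) `C^∞` submanifold `M ⊂ R^t`, and hypothesis-free for the gauge groups `U(N)`, `SU(N+1)` — PROVED

statement-level skeleton of published theorems with citation tags; proofs where landed; nothing here is a claim about the Yang–Mills mass gap

CITATION HEADER.  P. Federbush, *A phase cell approach to Yang–Mills theory. IV. The choice of variables*, Commun. Math.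
Phys. **114** (1988) 317–343 [Federbush1988PhaseCellIV], §11 («Gauge Interpolation – A Herculean Task») pp. 336–339:
Geometric Constructions 1 (11.4), 2 (11.5)–(11.6), 3 (11.7)–(11.8), 4, 5 (11.10)–(11.11), 6 (11.12)–(11.13); Appendix A
Theorems A.1–A.4 pp. 339–343.  Cell `lit-balaban`, Phase-2 proof seat **r19 gen 11** (F4 fold owner); SKELETON rows
**F4.Def§11**, F4.ThmA.1–A.4.  A SUMMARY FILE: no new mathematics — it conjoins the tree's theorems
`PhaseCellIVAppA.thmA1Emb_of_submanifold` (p299964), `thmA2Emb_of_submanifold` / `thmA3ContCap_of_submanifold` /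
`thmA4ContCap_of_submanifold` / `geomConstruction4_of_submanifold` (p299476), `geomConstruction1_of_submanifold` /
`geomConstruction2_of_submanifold` / `geomConstruction3_of_submanifold` (p299964, p299713),
`PhaseCellIVGauge.geomConstruction5_of_submanifold` (p323366), `geomConstruction6_of_submanifold` (p324300), and their
compact-matrix-group forms (`PhaseCellIVCompactGroupTargets` p305705, `…_of_isCompact_subgroup`).

WHAT THIS MODULE PROVIDES (namespace `PhaseCellIVGauge`): theorems `section11_of_submanifold` (Constructions 2–6),
`section11_of_submanifold_of_isPreconnected` (Constructions 1–6), `appA_and_section11_of_submanifold` (A.1–A.4 and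
Constructions 1–6), `section11_of_isCompact_subgroup`, **`section11_unitaryGroup`**, **`section11_specialUnitaryGroup`**,
`appA_and_section11_unitaryGroup`.  No definitions, no named facts; axioms standard.
-/

namespace Literature.MathematicalPhysics.QuantumFieldTheory.Federbush1986

noncomputable section

open Metric Set

namespace PhaseCellIVGauge

open PhaseCellIVAppA Literature.AlgebraicGeometry.RealAlgebraic Literature.Analysis.Calculus

variable {t : ℕ}

/-! ## §1 Every compact `C^∞` submanifold `M ⊂ R^t` -/

/-- **§11 Geometric Constructions 2, 3, 4, 5, 6 for every compact `C^∞` submanifold `M ⊂ R^t`**, every cube dimension `k`,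
every centering radius `δ < ½` (Construction 1 needs `M` connected: next theorem). [cite: Federbush1988PhaseCellIV,
(11.5)–(11.8) pp. 337–338; Geometric Constructions 4, 5, 6 (11.10)–(11.13) pp. 338–339] -/
theorem section11_of_submanifold {d : ℕ} {M : Set (EuclideanSpace ℝ (Fin t))} (hMc : IsCompact M)
    (hM : IsSubmanifoldOfDim d (EuclideanSpace.equiv (Fin t) ℝ '' M)) (k : ℕ) {δ : ℝ} (hδ : δ < 1 / 2) :
    GeomConstruction2 t M ∧ GeomConstruction3 k t M ∧ GeomConstruction4 k t M ∧ GeomConstruction5 k t M ∧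
      GeomConstruction6 k t M δ :=
  ⟨geomConstruction2_of_submanifold hMc hM, geomConstruction3_of_submanifold hMc hM k,
    geomConstruction4_of_submanifold hMc hM k, geomConstruction5_of_submanifold hMc hM k,
    geomConstruction6_of_submanifold hMc hM k hδ⟩

/-- **§11 Geometric Constructions 1–6 for every compact connected `C^∞` submanifold `M ⊂ R^t`.**
[cite: Federbush1988PhaseCellIV, (11.4)–(11.8) pp. 337–338; Geometric Constructions 4, 5, 6 (11.10)–(11.13) pp. 338–339] -/
theorem section11_of_submanifold_of_isPreconnected {d : ℕ} {M : Set (EuclideanSpace ℝ (Fin t))} (hMc : IsCompact M)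
    (hconn : IsPreconnected M) (hM : IsSubmanifoldOfDim d (EuclideanSpace.equiv (Fin t) ℝ '' M)) (k : ℕ) {δ : ℝ}
    (hδ : δ < 1 / 2) :
    GeomConstruction1 t M ∧ GeomConstruction2 t M ∧ GeomConstruction3 k t M ∧ GeomConstruction4 k t M ∧
      GeomConstruction5 k t M ∧ GeomConstruction6 k t M δ :=
  ⟨geomConstruction1_of_submanifold hMc hconn hM, section11_of_submanifold hMc hM k hδ⟩

/-- **Appendix A Theorems A.1 (every cap), A.2, A.3, A.4 AND §11 Geometric Constructions 1–6 for every compact connected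
`C^∞` submanifold `M ⊂ R^t`** — print's generality («`M` a compact differentiable manifold (without boundary) … We now embed
`M` in some Euclidean space `R^t`», p. 342) under the embedded capped readings of record.
[cite: Federbush1988PhaseCellIV, Theorems A.1–A.4 pp. 339–343; §11 pp. 337–339] -/
theorem appA_and_section11_of_submanifold {d : ℕ} {M : Set (EuclideanSpace ℝ (Fin t))} (hMc : IsCompact M)
    (hconn : IsPreconnected M) (hM : IsSubmanifoldOfDim d (EuclideanSpace.equiv (Fin t) ℝ '' M)) (k : ℕ) {δ : ℝ}
    (hδ : δ < 1 / 2) :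
    (ThmA1Emb k t M ∧ ThmA2Emb k t M ∧ ThmA3ContCap k t M ∧ ThmA4ContCap k t M) ∧
      (GeomConstruction1 t M ∧ GeomConstruction2 t M ∧ GeomConstruction3 k t M ∧ GeomConstruction4 k t M ∧
        GeomConstruction5 k t M ∧ GeomConstruction6 k t M δ) :=
  ⟨⟨thmA1Emb_of_submanifold hMc hM k, thmA2Emb_of_submanifold hMc hM k, thmA3ContCap_of_submanifold hMc hM k,
      thmA4ContCap_of_submanifold hMc hM k⟩,
    section11_of_submanifold_of_isPreconnected hMc hconn hM k hδ⟩

/-! ## §2 Compact matrix groups, `U(N)`, `SU(N+1)` — hypothesis-free -/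

section CompactSubgroup

variable {N : ℕ} {H : Set (Matrix (Fin N) (Fin N) ℂ)} (hHc : IsCompact H) (h1 : (1 : Matrix (Fin N) (Fin N) ℂ) ∈ H)
  (hmul : ∀ a ∈ H, ∀ b ∈ H, a * b ∈ H) (hinv : ∀ a ∈ H, ∃ b ∈ H, b * a = 1)
include hHc h1 hmul hinv

/-- **§11 Geometric Constructions 2–6 for a compact matrix group `M = Ψ(H)`** (`Ψ` any real-linear identification
`M_N(ℂ) ≅ R^t`), and Construction 1 as well when `H` is connected. [cite: Federbush1988PhaseCellIV, §11 pp. 336–339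
(«a mapping `φ : x → G`»)] -/
theorem section11_of_isCompact_subgroup (Ψ : Matrix (Fin N) (Fin N) ℂ ≃L[ℝ] EuclideanSpace ℝ (Fin t)) (k : ℕ) {δ : ℝ}
    (hδ : δ < 1 / 2) :
    (IsPreconnected H → GeomConstruction1 t (Ψ '' H)) ∧ GeomConstruction2 t (Ψ '' H) ∧ GeomConstruction3 k t (Ψ '' H) ∧
      GeomConstruction4 k t (Ψ '' H) ∧ GeomConstruction5 k t (Ψ '' H) ∧ GeomConstruction6 k t (Ψ '' H) δ :=
  ⟨fun hconn => geomConstruction1_of_isCompact_subgroup hHc h1 hmul hinv hconn Ψ,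
    geomConstruction2_of_isCompact_subgroup hHc h1 hmul hinv Ψ,
    geomConstruction3_of_thmA1Emb (thmA1Emb_of_isCompact_subgroup hHc h1 hmul hinv Ψ k),
    geomConstruction4_of_isCompact_subgroup hHc h1 hmul hinv Ψ k, geomConstruction5_of_isCompact_subgroup hHc h1 hmul hinv Ψ k,
    geomConstruction6_of_isCompact_subgroup hHc h1 hmul hinv Ψ k hδ⟩

end CompactSubgroup

/-- **§11 Geometric Constructions 1–6 for the gauge group `U(N)`, hypothesis-free** — every `N`, every cube dimension `k`,
every centering radius `δ < ½`, every real-linear identification `Ψ : M_N(ℂ) ≃L[ℝ] R^t`.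
[cite: Federbush1988PhaseCellIV, §11 Geometric Constructions 1–6 (11.4)–(11.13) pp. 337–339] -/
theorem section11_unitaryGroup {N : ℕ} (Ψ : Matrix (Fin N) (Fin N) ℂ ≃L[ℝ] EuclideanSpace ℝ (Fin t)) (k : ℕ) {δ : ℝ}
    (hδ : δ < 1 / 2) :
    GeomConstruction1 t (Ψ '' (Matrix.unitaryGroup (Fin N) ℂ : Set (Matrix (Fin N) (Fin N) ℂ))) ∧
      GeomConstruction2 t (Ψ '' (Matrix.unitaryGroup (Fin N) ℂ : Set (Matrix (Fin N) (Fin N) ℂ))) ∧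
      GeomConstruction3 k t (Ψ '' (Matrix.unitaryGroup (Fin N) ℂ : Set (Matrix (Fin N) (Fin N) ℂ))) ∧
      GeomConstruction4 k t (Ψ '' (Matrix.unitaryGroup (Fin N) ℂ : Set (Matrix (Fin N) (Fin N) ℂ))) ∧
      GeomConstruction5 k t (Ψ '' (Matrix.unitaryGroup (Fin N) ℂ : Set (Matrix (Fin N) (Fin N) ℂ))) ∧
      GeomConstruction6 k t (Ψ '' (Matrix.unitaryGroup (Fin N) ℂ : Set (Matrix (Fin N) (Fin N) ℂ))) δ := by
  obtain ⟨hc, h1, hmul, hinv⟩ := unitaryGroup_hyps N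
  obtain ⟨hG1, hrest⟩ := section11_of_isCompact_subgroup hc h1 hmul hinv Ψ k hδ
  exact ⟨hG1 (isPreconnected_unitaryGroup N), hrest⟩

/-- **§11 Geometric Constructions 1–6 for the gauge group `SU(N+1)`, hypothesis-free.**
[cite: Federbush1988PhaseCellIV, §11 Geometric Constructions 1–6 (11.4)–(11.13) pp. 337–339] -/
theorem section11_specialUnitaryGroup {N : ℕ} (Ψ : Matrix (Fin (N + 1)) (Fin (N + 1)) ℂ ≃L[ℝ] EuclideanSpace ℝ (Fin t))
    (k : ℕ) {δ : ℝ} (hδ : δ < 1 / 2) :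
    GeomConstruction1 t (Ψ '' (Matrix.specialUnitaryGroup (Fin (N + 1)) ℂ : Set (Matrix (Fin (N + 1)) (Fin (N + 1)) ℂ))) ∧
      GeomConstruction2 t (Ψ '' (Matrix.specialUnitaryGroup (Fin (N + 1)) ℂ : Set (Matrix (Fin (N + 1)) (Fin (N + 1)) ℂ))) ∧
      GeomConstruction3 k t
          (Ψ '' (Matrix.specialUnitaryGroup (Fin (N + 1)) ℂ : Set (Matrix (Fin (N + 1)) (Fin (N + 1)) ℂ))) ∧
      GeomConstruction4 k t
          (Ψ '' (Matrix.specialUnitaryGroup (Fin (N + 1)) ℂ : Set (Matrix (Fin (N + 1)) (Fin (N + 1)) ℂ))) ∧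
      GeomConstruction5 k t
          (Ψ '' (Matrix.specialUnitaryGroup (Fin (N + 1)) ℂ : Set (Matrix (Fin (N + 1)) (Fin (N + 1)) ℂ))) ∧
      GeomConstruction6 k t
          (Ψ '' (Matrix.specialUnitaryGroup (Fin (N + 1)) ℂ : Set (Matrix (Fin (N + 1)) (Fin (N + 1)) ℂ))) δ := by
  obtain ⟨hc, h1, hmul, hinv⟩ := specialUnitaryGroup_hyps (N + 1)
  obtain ⟨hG1, hrest⟩ := section11_of_isCompact_subgroup hc h1 hmul hinv Ψ k hδ
  exact ⟨hG1 (isPreconnected_specialUnitaryGroup N), hrest⟩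

/-- **Everything §11 uses, for `U(N)`, in one decl**: Theorems A.1 (every cap), A.2, A.3, A.4 and Geometric Constructions
1–6, hypothesis-free. [cite: Federbush1988PhaseCellIV, Theorems A.1–A.4 pp. 339–343; §11 (11.4)–(11.13) pp. 337–339] -/
theorem appA_and_section11_unitaryGroup {N : ℕ} (Ψ : Matrix (Fin N) (Fin N) ℂ ≃L[ℝ] EuclideanSpace ℝ (Fin t)) (k : ℕ)
    {δ : ℝ} (hδ : δ < 1 / 2) :
    (ThmA1Emb k t (Ψ '' (Matrix.unitaryGroup (Fin N) ℂ : Set (Matrix (Fin N) (Fin N) ℂ))) ∧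
        ThmA2Emb k t (Ψ '' (Matrix.unitaryGroup (Fin N) ℂ : Set (Matrix (Fin N) (Fin N) ℂ))) ∧
        ThmA3ContCap k t (Ψ '' (Matrix.unitaryGroup (Fin N) ℂ : Set (Matrix (Fin N) (Fin N) ℂ))) ∧
        ThmA4ContCap k t (Ψ '' (Matrix.unitaryGroup (Fin N) ℂ : Set (Matrix (Fin N) (Fin N) ℂ)))) ∧
      (GeomConstruction1 t (Ψ '' (Matrix.unitaryGroup (Fin N) ℂ : Set (Matrix (Fin N) (Fin N) ℂ))) ∧
        GeomConstruction2 t (Ψ '' (Matrix.unitaryGroup (Fin N) ℂ : Set (Matrix (Fin N) (Fin N) ℂ))) ∧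
        GeomConstruction3 k t (Ψ '' (Matrix.unitaryGroup (Fin N) ℂ : Set (Matrix (Fin N) (Fin N) ℂ))) ∧
        GeomConstruction4 k t (Ψ '' (Matrix.unitaryGroup (Fin N) ℂ : Set (Matrix (Fin N) (Fin N) ℂ))) ∧
        GeomConstruction5 k t (Ψ '' (Matrix.unitaryGroup (Fin N) ℂ : Set (Matrix (Fin N) (Fin N) ℂ))) ∧
        GeomConstruction6 k t (Ψ '' (Matrix.unitaryGroup (Fin N) ℂ : Set (Matrix (Fin N) (Fin N) ℂ))) δ) := by
  obtain ⟨hA1, hA2, hA3, hA4, -⟩ := appA_unitaryGroup' Ψ k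
  exact ⟨⟨hA1, hA2, hA3, hA4⟩, section11_unitaryGroup Ψ k hδ⟩

end PhaseCellIVGauge

end

end Literature.MathematicalPhysics.QuantumFieldTheory.Federbush1986
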